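import Summits.AtomisticToContinuum.HydrodynamicLimit.Theses.AntiMazurCoboundaries
import Summits.AtomisticToContinuum.HydrodynamicLimit.Theorems.AntiMazurCoboundariesKineticWindowGronwallLadderWindowUpgrade
import HarnessLib

/-!
# The amplitude ladder: bounded bulk ∧ rare band ⟹ quadratic class (stub `stub_ladderAssembly`)

Crux `Summit.AtomisticToContinuum.HydrodynamicLimit.Theses.AntiMazurCoboundaries.KineticWindowGronwall`
(stmt-AtomisticToContinuum-9282, `= KineticFluxLdDecay → RelEntropyVanishing`), skeleton line `rare-band-ladder-dock` (v2),
registered stub `stub_ladderAssembly : LadderAssembly`,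
`LadderAssembly := ReorthogonalisingCut → AmplitudeLadder`,
`AmplitudeLadder := KineticFluxLdDecay → RareBandLdDecay → QuadraticClassLdDecay` — helper file 2 of 2 (file 1:
`…KineticWindowGronwallLadderWindowUpgrade`, the window upgrade, the static bounds and the Cauchy–Schwarz split).

THE THEOREM THAT THE CRUX'S ANTECEDENT IS NOT IDLE. `KineticFluxLdDecay` (A; bounded class `|g| ≤ κ`, window
exponential moments `≤ e^{δ(N+1)}` under the invariant homogeneous Gibbs law) is USED at its own amplitude `κ` on the
bounded bulk piece `G₁` of the re-orthogonalising cut `g = G₁ + G₂` of a quadratic-class profile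
`|g w| ≤ c⋆_Q (1 + ‖w‖²)`, `g ⊥ (1, w, ‖w‖²)`; the rare band (`RareBandLdDecay`) handles the band-supported quadratic
piece `G₂`; both windows are upgraded from `∃ τ` to every larger window (file 1, `window_upgrade`: subadditivity +
two-window Hölder + Jensen-in-time static bounds — bounded resp. Gaussian-quadratic), a common window is taken, and one
Cauchy–Schwarz inequality on the window functional (`window_split_le_geomMean`) gives the quadratic class at amplitude
`c⋆_Q := min(κ, c⋆, 1/4) / (2K)`, `K = K(V₁)` the constant of the cut. Statements `TFlow`, `Orth`, `RareBandLdDecay`,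
`QuadraticClassLdDecay`, `AmplitudeLadder`, `ReorthogonalisingCut`, `LadderAssembly` are re-declared verbatim from the
registered skeleton `Cruxes/KineticWindowGronwall/Lines/rare_band_ladder_dock.lean` (v2).

References: S. Olla, S. R. S. Varadhan, H.-T. Yau, Comm. Math. Phys. 155 (1993) §2–3; B. Nachtergaele, H.-T. Yau,
Comm. Math. Phys. 243 (2003) §5 (the quadratic currency of the entropy method).
-/

noncomputable section

open MeasureTheory Set Filter
open scoped ENNReal
open Literature.Analysis.FluidPDE Literature.MathematicalPhysics.KineticTheory
open Summit.AtomisticToContinuum.HydrodynamicLimit.Theses.AntiMazurCoboundaries (KineticFluxLdDecay)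

namespace Summit.AtomisticToContinuum.HydrodynamicLimit.Theorems.KineticWindowGronwallLadder

/-! ## §1 Statements (verbatim from the registered skeleton, v2) -/

/-- The hard-sphere flow of `N+1` spheres at reduced density `σ` on `𝕋³`. -/
abbrev TFlow (σ : ℝ) (N : ℕ) : Type :=
  HardSphereFlow (Torus.geometry (Fin 3)) (hsDiameter σ N) (N + 1)

/-- The orthogonality clause of all kinetic statements of this line (verbatim the clause of `KineticFluxLdDecay`):
`g ⊥ span{1, w, ‖w‖²}` in `L²(stdGaussian)` — the thermal-frame collision invariants. -/
def Orth (g : V3 → ℝ) : Prop :=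
  ∀ (c₀ c₂ : ℝ) (b : V3), ∫ v, g v * (c₀ + inner ℝ b v + c₂ * ‖v‖ ^ 2) ∂(ProbabilityTheory.stdGaussian V3) = 0

/-- **RARE-BAND LD DECAY** (verbatim from the skeleton): the frame of `KineticFluxLdDecay` with the bounded amplitude
clause replaced by `∃ c⋆ > 0, ∃ V₁ > 0`: continuous `φ, g`, `|φ| ≤ 1`, `|g w| ≤ c⋆ ‖w‖²`, `g = 0` on `‖w‖ ≤ V₁`,
`g ⊥ span(1, w, ‖w‖²)`; `∀ δ > 0 ∃ τ, N₀ ∀ N ≥ N₀ ∀ Φ`, window exponential moment `≤ e^{δ(N+1)}`. An OPEN equilibrium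
large-deviation statement (the line's load-bearing new lemma; no proof is claimed here — it is a HYPOTHESIS of the
ladder). -/
def RareBandLdDecay : Prop :=
  ∀ (a θ : ℝ) (u₀ : V3), 0 < a → 0 < θ → ∃ σ₀ : ℝ, 0 < σ₀ ∧
    ∀ σ : ℝ, 0 < σ → σ < σ₀ →
    (∀ (N : ℕ) (Φ : TFlow σ N),
      IsProbabilityMeasure (localGibbsLaw σ (fun _ => a) (fun _ => u₀) (fun _ => θ) N Φ)) ∧
    ∃ cstar : ℝ, 0 < cstar ∧ ∃ V₁ : ℝ, 0 < V₁ ∧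
    ∀ (φ : T3 → ℝ) (g : V3 → ℝ), Continuous φ → Continuous g → (∀ x, |φ x| ≤ 1) →
      (∀ v, |g v| ≤ cstar * ‖v‖ ^ 2) → (∀ v, ‖v‖ ≤ V₁ → g v = 0) → Orth g →
      ∀ δ : ℝ, 0 < δ → ∃ τ : ℝ, 0 < τ ∧ ∃ N₀ : ℕ, ∀ N : ℕ, N₀ ≤ N → ∀ Φ : TFlow σ N,
        ∫⁻ z, ENNReal.ofReal (Real.exp ((τ * ((N + 1 : ℕ) : ℝ) ^ (-(1 / 3 : ℝ)))⁻¹ *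
            ∫ s in (0 : ℝ)..(τ * ((N + 1 : ℕ) : ℝ) ^ (-(1 / 3 : ℝ))),
              ∑ i, φ (Φ.flow s z i).1 * g ((Real.sqrt θ)⁻¹ • ((Φ.flow s z i).2 - u₀))))
          ∂(localGibbsLaw σ (fun _ => a) (fun _ => u₀) (fun _ => θ) N Φ)
        ≤ ENNReal.ofReal (Real.exp (δ * (N + 1)))

/-- **QUADRATIC-CLASS LD DECAY AT GLOBAL EQUILIBRIUM** (verbatim from the skeleton): `KineticFluxLdDecay` with the
bounded class replaced by the Gaussian-dominated quadratic class `|g w| ≤ c⋆(1 + ‖w‖²)`, amplitude `c⋆` AFTER `σ`. -/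
def QuadraticClassLdDecay : Prop :=
  ∀ (a θ : ℝ) (u₀ : V3), 0 < a → 0 < θ → ∃ σ₀ : ℝ, 0 < σ₀ ∧
    ∀ σ : ℝ, 0 < σ → σ < σ₀ →
    (∀ (N : ℕ) (Φ : TFlow σ N),
      IsProbabilityMeasure (localGibbsLaw σ (fun _ => a) (fun _ => u₀) (fun _ => θ) N Φ)) ∧
    ∃ cstar : ℝ, 0 < cstar ∧
    ∀ (φ : T3 → ℝ) (g : V3 → ℝ), Continuous φ → Continuous g → (∀ x, |φ x| ≤ 1) →
      (∀ v, |g v| ≤ cstar * (1 + ‖v‖ ^ 2)) → Orth g →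
      ∀ δ : ℝ, 0 < δ → ∃ τ : ℝ, 0 < τ ∧ ∃ N₀ : ℕ, ∀ N : ℕ, N₀ ≤ N → ∀ Φ : TFlow σ N,
        ∫⁻ z, ENNReal.ofReal (Real.exp ((τ * ((N + 1 : ℕ) : ℝ) ^ (-(1 / 3 : ℝ)))⁻¹ *
            ∫ s in (0 : ℝ)..(τ * ((N + 1 : ℕ) : ℝ) ^ (-(1 / 3 : ℝ))),
              ∑ i, φ (Φ.flow s z i).1 * g ((Real.sqrt θ)⁻¹ • ((Φ.flow s z i).2 - u₀))))
          ∂(localGibbsLaw σ (fun _ => a) (fun _ => u₀) (fun _ => θ) N Φ)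
        ≤ ENNReal.ofReal (Real.exp (δ * (N + 1)))

/-- **THE AMPLITUDE LADDER** (verbatim from the skeleton): the bounded class (crux antecedent `KineticFluxLdDecay`,
amplitude `κ(σ)`) and the rare band give the quadratic class. -/
def AmplitudeLadder : Prop :=
  KineticFluxLdDecay → RareBandLdDecay → QuadraticClassLdDecay

/-- **THE RE-ORTHOGONALISING CUT** (verbatim from the skeleton; static Gaussian analysis, the neighbouring registered stub
`stub_reorthCut`): for every bulk radius `V₁ > 0` a constant `K = K(V₁) > 0` such that every continuous orthogonal `g`
of quadratic growth `|g w| ≤ c (1 + ‖w‖²)` splits as `g = G₁ + G₂`, `G₁` continuous bounded by `K c` and orthogonal,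
`G₂` continuous orthogonal vanishing on `‖w‖ ≤ V₁` with `|G₂ w| ≤ K c ‖w‖²`. -/
def ReorthogonalisingCut : Prop :=
  ∀ V₁ : ℝ, 0 < V₁ → ∃ K : ℝ, 0 < K ∧
    ∀ (c : ℝ) (g : V3 → ℝ), 0 ≤ c → Continuous g → (∀ w, |g w| ≤ c * (1 + ‖w‖ ^ 2)) → Orth g →
      ∃ G₁ G₂ : V3 → ℝ, Continuous G₁ ∧ Continuous G₂ ∧ (∀ w, g w = G₁ w + G₂ w) ∧
        (∀ w, |G₁ w| ≤ K * c) ∧ Orth G₁ ∧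
        (∀ w, ‖w‖ ≤ V₁ → G₂ w = 0) ∧ (∀ w, |G₂ w| ≤ K * c * ‖w‖ ^ 2) ∧ Orth G₂

/-- **THE LADDER ASSEMBLY** (verbatim from the skeleton; signature of the registered stub `stub_ladderAssembly`): given
the cut, the bounded class and the rare band give the quadratic class. -/
def LadderAssembly : Prop :=
  ReorthogonalisingCut → AmplitudeLadder

/-! ## §2 Small lemmas -/

/-- Orthogonality is stable under scalar multiples. [folklore] -/
theorem orth_const_mul (c : ℝ) {G : V3 → ℝ} (hG : Orth G) : Orth fun w => c * G w := by
  intro c₀ c₂ b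
  have h := hG c₀ c₂ b
  have hpt : (fun v : V3 => c * G v * (c₀ + inner ℝ b v + c₂ * ‖v‖ ^ 2)) =
      fun v => c * (G v * (c₀ + inner ℝ b v + c₂ * ‖v‖ ^ 2)) := by
    funext v; ring
  rw [hpt, integral_const_mul, h, mul_zero]

/-- The one-body sum `y ↦ Σᵢ φ(xᵢ) G((vᵢ − u₀)/√θ)` is continuous on phase space for continuous `φ, G`. [folklore] -/
theorem continuous_oneBodySum {N : ℕ} {φ : T3 → ℝ} {G : V3 → ℝ} (hφ : Continuous φ) (hG : Continuous G) (θ : ℝ)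
    (u₀ : V3) :
    Continuous fun y : Config (N + 1) (Fin 3) T3 => ∑ i, φ (y i).1 * G ((Real.sqrt θ)⁻¹ • ((y i).2 - u₀)) := by
  refine continuous_finsetSum _ fun i _ => ?_
  have hi : Continuous fun y : Config (N + 1) (Fin 3) T3 => y i := continuous_apply i
  have hsm : Continuous fun y : Config (N + 1) (Fin 3) T3 => (Real.sqrt θ)⁻¹ • ((y i).2 - u₀) := by fun_prop
  exact (hφ.comp hi.fst).mul (hG.comp hsm)

/-- The one-body sum against `|φ| ≤ 1`, `|G| ≤ κ` is at most `κ (N+1)`. [folklore] -/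
theorem oneBodySum_le {N : ℕ} {φ : T3 → ℝ} {G : V3 → ℝ} {κ : ℝ} (hφ : ∀ x, |φ x| ≤ 1) (hG : ∀ w, |G w| ≤ κ)
    (θ : ℝ) (u₀ : V3) (y : Config (N + 1) (Fin 3) T3) :
    ∑ i, φ (y i).1 * G ((Real.sqrt θ)⁻¹ • ((y i).2 - u₀)) ≤ κ * (N + 1) := by
  calc ∑ i, φ (y i).1 * G ((Real.sqrt θ)⁻¹ • ((y i).2 - u₀)) ≤ ∑ _i : Fin (N + 1), κ :=
        Finset.sum_le_sum fun i _ => by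
          have h1 : |φ (y i).1 * G ((Real.sqrt θ)⁻¹ • ((y i).2 - u₀))| ≤ κ := by
            rw [abs_mul]
            calc |φ (y i).1| * |G ((Real.sqrt θ)⁻¹ • ((y i).2 - u₀))| ≤ 1 * κ :=
                  mul_le_mul (hφ _) (hG _) (abs_nonneg _) zero_le_one
              _ = κ := one_mul κ
          exact (abs_le.1 h1).2
    _ = κ * (N + 1) := by
        simp only [Finset.sum_const, Finset.card_univ, Fintype.card_fin, nsmul_eq_mul, Nat.cast_add, Nat.cast_one]
        ring

/-! ## §3 The stub -/

/-- **STUB `stub_ladderAssembly` (line `rare-band-ladder-dock`, crux stmt-AtomisticToContinuum-9282): the amplitude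
ladder.** Given the re-orthogonalising cut, `KineticFluxLdDecay ∧ RareBandLdDecay → QuadraticClassLdDecay`, with
`σ₀ := min(σ₀^A, σ₀^R, 1/2)` and amplitude `c⋆_Q := min(κ, c⋆, 1/4)/(2K(V₁))`. For `(φ, g, δ)`: cut `g = G₁ + G₂` at
growth constant `c⋆_Q` (so `|2G₁| ≤ κ`, `|2G₂ w| ≤ min(c⋆, 1/4)‖w‖²`), run A on `(φ, 2G₁)` and the rare band on `(φ, 2G₂)`
at `δ/4`, upgrade both to the common window `τ := max(τ_A, τ_R, 4κτ_A/δ, 8τ_R/δ)` (file 1: exponents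
`δ/4 + κτ_A/τ ≤ δ/2`, `δ/4 + 2τ_R/τ ≤ δ/2`), and split by Cauchy–Schwarz: `≤ e^{δ(N+1)/2} ≤ e^{δ(N+1)}`.
[cite: OllaVaradhanYau1993, §2–3] -/
theorem stub_ladderAssembly : LadderAssembly := by
  intro hCut hA hR a θ u₀ ha hθ
  obtain ⟨σA, hσA, HA⟩ := hA a θ u₀ ha hθ
  obtain ⟨σR, hσR, HR⟩ := hR a θ u₀ ha hθ
  refine ⟨min (min σA σR) (1 / 2), lt_min (lt_min hσA hσR) (by norm_num), fun σ hσ hσlt => ?_⟩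
  have hσA' : σ < σA := hσlt.trans_le ((min_le_left _ _).trans (min_le_left _ _))
  have hσR' : σ < σR := hσlt.trans_le ((min_le_left _ _).trans (min_le_right _ _))
  have hσ2 : σ ≤ 1 / 2 := (hσlt.trans_le (min_le_right _ _)).le
  obtain ⟨hprob, κ, hκ, HAb⟩ := HA σ hσ hσA'
  obtain ⟨-, cR, hcR, V₁, hV₁, HRb⟩ := HR σ hσ hσR'
  refine ⟨hprob, ?_⟩
  obtain ⟨K, hK, Hcut⟩ := hCut V₁ hV₁
  -- the amplitude of the quadratic class
  set cR' : ℝ := min cR (1 / 4) with hcR'def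
  have hcR'pos : 0 < cR' := lt_min hcR (by norm_num)
  have hcR'le : cR' ≤ cR := min_le_left _ _
  have hcR'q : cR' ≤ 1 / 4 := min_le_right _ _
  have hmin : 0 < min κ cR' := lt_min hκ hcR'pos
  set cQ : ℝ := min κ cR' / (2 * K) with hcQdef
  have hcQ : 0 < cQ := div_pos hmin (by positivity)
  have hKcQ : K * cQ = min κ cR' / 2 := by
    rw [hcQdef]
    field_simp
  refine ⟨cQ, hcQ, fun φ g hφ hg hφ1 hgq horth δ hδ => ?_⟩
  obtain ⟨G₁, G₂, hG₁c, hG₂c, hsum, hG₁b, hG₁o, hG₂v, hG₂b, hG₂o⟩ := Hcut cQ g hcQ.le hg hgq horth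
  -- the two doubled pieces and their classes
  have h2G₁b : ∀ w, |2 * G₁ w| ≤ κ := fun w => by
    rw [abs_mul, abs_two]
    calc 2 * |G₁ w| ≤ 2 * (K * cQ) := by gcongr; exact hG₁b w
      _ = min κ cR' := by rw [hKcQ]; ring
      _ ≤ κ := min_le_left _ _
  have h2G₂b : ∀ w, |2 * G₂ w| ≤ cR' * ‖w‖ ^ 2 := fun w => by
    rw [abs_mul, abs_two]
    calc 2 * |G₂ w| ≤ 2 * (K * cQ * ‖w‖ ^ 2) := by gcongr; exact hG₂b w
      _ = min κ cR' * ‖w‖ ^ 2 := by rw [hKcQ]; ring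
      _ ≤ cR' * ‖w‖ ^ 2 := mul_le_mul_of_nonneg_right (min_le_right _ _) (sq_nonneg _)
  have h2G₂bR : ∀ w, |2 * G₂ w| ≤ cR * ‖w‖ ^ 2 := fun w =>
    (h2G₂b w).trans (mul_le_mul_of_nonneg_right hcR'le (sq_nonneg _))
  have h2G₂bq : ∀ w, |2 * G₂ w| ≤ (1 / 4 : ℝ) * ‖w‖ ^ 2 := fun w =>
    (h2G₂b w).trans (mul_le_mul_of_nonneg_right hcR'q (sq_nonneg _))
  have h2G₁c : Continuous fun w => 2 * G₁ w := continuous_const.mul hG₁c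
  have h2G₂c : Continuous fun w => 2 * G₂ w := continuous_const.mul hG₂c
  have h2G₁o : Orth fun w => 2 * G₁ w := orth_const_mul 2 hG₁o
  have h2G₂o : Orth fun w => 2 * G₂ w := orth_const_mul 2 hG₂o
  have h2G₂v : ∀ w, ‖w‖ ≤ V₁ → 2 * G₂ w = 0 := fun w hw => by rw [hG₂v w hw, mul_zero]
  -- run the two hypotheses at `δ / 4`
  have hδ4 : 0 < δ / 4 := by positivity
  obtain ⟨τA, hτA, NA, HNA⟩ := HAb φ (fun w => 2 * G₁ w) hφ h2G₁c hφ1 h2G₁b h2G₁o (δ / 4) hδ4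
  obtain ⟨τR, hτR, NR, HNR⟩ := HRb φ (fun w => 2 * G₂ w) hφ h2G₂c hφ1 h2G₂bR h2G₂v h2G₂o (δ / 4) hδ4
  -- the common window
  set τ : ℝ := max (max τA τR) (max (4 * κ * τA / δ) (8 * τR / δ)) with hτdef
  have hτpos : 0 < τ := lt_max_of_lt_left (lt_max_of_lt_left hτA)
  have hτA_le : τA ≤ τ := (le_max_left _ _).trans (le_max_left _ _)
  have hτR_le : τR ≤ τ := (le_max_right _ _).trans (le_max_left _ _)
  have hτA' : 4 * κ * τA / δ ≤ τ := (le_max_left _ _).trans (le_max_right _ _)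
  have hτR' : 8 * τR / δ ≤ τ := (le_max_right _ _).trans (le_max_right _ _)
  refine ⟨τ, hτpos, max NA NR, fun N hN Φ => ?_⟩
  have hNA : NA ≤ N := (le_max_left _ _).trans hN
  have hNR : NR ≤ N := (le_max_right _ _).trans hN
  have hA1 := HNA N hNA Φ
  have hR1 := HNR N hNR Φ
  set ℓ : ℝ := ((N + 1 : ℕ) : ℝ) ^ (-(1 / 3 : ℝ)) with hℓdef
  have hℓpos : 0 < ℓ := Real.rpow_pos_of_pos (by positivity) _
  have hN1 : (0 : ℝ) < (N : ℝ) + 1 := by positivity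
  set P := localGibbsLaw σ (fun _ => a) (fun _ => u₀) (fun _ => θ) N Φ with hPdef
  haveI : IsProbabilityMeasure P := hprob N Φ
  have hgood : P Φ.goodᶜ = 0 :=
    mem_ae_iff.1 (KineticWindowGronwallQuadraticMoment.ae_mem_good_localGibbsLaw σ (fun _ => a) (fun _ => u₀)
      (fun _ => θ) N Φ)
  -- the three one-body sums
  set F : Config (N + 1) (Fin 3) T3 → ℝ := fun y =>
    ∑ i, φ (y i).1 * g ((Real.sqrt θ)⁻¹ • ((y i).2 - u₀)) with hFdef
  set F₁ : Config (N + 1) (Fin 3) T3 → ℝ := fun y =>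
    ∑ i, φ (y i).1 * (2 * G₁ ((Real.sqrt θ)⁻¹ • ((y i).2 - u₀))) with hF₁def
  set F₂ : Config (N + 1) (Fin 3) T3 → ℝ := fun y =>
    ∑ i, φ (y i).1 * (2 * G₂ ((Real.sqrt θ)⁻¹ • ((y i).2 - u₀))) with hF₂def
  have hF₁c : Continuous F₁ := continuous_oneBodySum (G := fun w => 2 * G₁ w) hφ h2G₁c θ u₀
  have hF₂c : Continuous F₂ := continuous_oneBodySum (G := fun w => 2 * G₂ w) hφ h2G₂c θ u₀
  have hFsum : ∀ y, F y = (1 / 2 : ℝ) * F₁ y + (1 / 2 : ℝ) * F₂ y := by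
    intro y
    simp only [hFdef, hF₁def, hF₂def, Finset.mul_sum, ← Finset.sum_add_distrib]
    refine Finset.sum_congr rfl fun i _ => ?_
    rw [hsum]
    ring
  -- static bounds
  have hSA : ∫⁻ z, ENNReal.ofReal (Real.exp (F₁ z)) ∂P ≤ ENNReal.ofReal (Real.exp (κ * (N + 1))) :=
    lintegral_exp_le_of_le P fun z => oneBodySum_le hφ1 h2G₁b θ u₀ z
  have hSR : ∫⁻ z, ENNReal.ofReal (Real.exp (F₂ z)) ∂P ≤ ENNReal.ofReal (Real.exp (2 * (N + 1))) :=
    lintegral_exp_oneBody_quarter_le hσ2 ha hθ u₀ N Φ hφ h2G₂c hφ1 h2G₂bq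
  -- upgraded windows at the common window `τ ℓ`
  have hhA : τA * ℓ ≤ τ * ℓ := mul_le_mul_of_nonneg_right hτA_le hℓpos.le
  have hhR : τR * ℓ ≤ τ * ℓ := mul_le_mul_of_nonneg_right hτR_le hℓpos.le
  have hWA := window_upgrade hσ2 ha hθ u₀ N Φ hF₁c (mul_pos hτA hℓpos) hδ4.le hκ.le hA1 hSA hhA
  have hWR := window_upgrade hσ2 ha hθ u₀ N Φ hF₂c (mul_pos hτR hℓpos) hδ4.le zero_le_two hR1 hSR hhR
  -- the exponents are at most `δ/2`
  have hratioA : δ / 4 + κ * (τA * ℓ / (τ * ℓ)) ≤ δ / 2 := by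
    rw [mul_div_mul_right _ _ hℓpos.ne']
    have h1 : κ * (τA / τ) ≤ δ / 4 := by
      rw [mul_div_assoc', div_le_iff₀ hτpos]
      calc κ * τA = (4 * κ * τA / δ) * (δ / 4) := by field_simp
        _ ≤ τ * (δ / 4) := mul_le_mul_of_nonneg_right hτA' hδ4.le
        _ = δ / 4 * τ := mul_comm _ _
    linarith
  have hratioR : δ / 4 + 2 * (τR * ℓ / (τ * ℓ)) ≤ δ / 2 := by
    rw [mul_div_mul_right _ _ hℓpos.ne']
    have h1 : 2 * (τR / τ) ≤ δ / 4 := by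
      rw [mul_div_assoc', div_le_iff₀ hτpos]
      calc 2 * τR = (8 * τR / δ) * (δ / 4) := by field_simp; ring
        _ ≤ τ * (δ / 4) := mul_le_mul_of_nonneg_right hτR' hδ4.le
        _ = δ / 4 * τ := mul_comm _ _
    linarith
  have hWA' : ∫⁻ z, ENNReal.ofReal (Real.exp ((τ * ℓ)⁻¹ * ∫ s in (0 : ℝ)..(τ * ℓ), F₁ (Φ.flow s z))) ∂P ≤
      ENNReal.ofReal (Real.exp (δ / 2 * (N + 1))) :=
    hWA.trans (ENNReal.ofReal_le_ofReal (Real.exp_le_exp.2 (mul_le_mul_of_nonneg_right hratioA hN1.le)))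
  have hWR' : ∫⁻ z, ENNReal.ofReal (Real.exp ((τ * ℓ)⁻¹ * ∫ s in (0 : ℝ)..(τ * ℓ), F₂ (Φ.flow s z))) ∂P ≤
      ENNReal.ofReal (Real.exp (δ / 2 * (N + 1))) :=
    hWR.trans (ENNReal.ofReal_le_ofReal (Real.exp_le_exp.2 (mul_le_mul_of_nonneg_right hratioR hN1.le)))
  -- Cauchy–Schwarz
  have hsplit := window_split_le_geomMean Φ hgood (F := F) hF₁c hF₂c hFsum (τ * ℓ)
  have hhalf : ENNReal.ofReal (Real.exp (δ / 2 * (N + 1))) ^ (1 / 2 : ℝ) =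
      ENNReal.ofReal (Real.exp ((1 / 2 : ℝ) * (δ / 2 * (N + 1)))) :=
    (KineticWindowGronwallWindowSubadditivity.ofReal_exp_mul_left (1 / 2 : ℝ) _ (by norm_num)).symm
  calc ∫⁻ z, ENNReal.ofReal (Real.exp ((τ * ℓ)⁻¹ * ∫ s in (0 : ℝ)..(τ * ℓ), F (Φ.flow s z))) ∂P
      ≤ (∫⁻ z, ENNReal.ofReal (Real.exp ((τ * ℓ)⁻¹ * ∫ s in (0 : ℝ)..(τ * ℓ), F₁ (Φ.flow s z))) ∂P) ^ (1 / 2 : ℝ) *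
        (∫⁻ z, ENNReal.ofReal (Real.exp ((τ * ℓ)⁻¹ * ∫ s in (0 : ℝ)..(τ * ℓ), F₂ (Φ.flow s z))) ∂P) ^ (1 / 2 : ℝ) :=
        hsplit
    _ ≤ ENNReal.ofReal (Real.exp (δ / 2 * (N + 1))) ^ (1 / 2 : ℝ) *
        ENNReal.ofReal (Real.exp (δ / 2 * (N + 1))) ^ (1 / 2 : ℝ) :=
        mul_le_mul' (ENNReal.rpow_le_rpow hWA' (by norm_num)) (ENNReal.rpow_le_rpow hWR' (by norm_num))
    _ = ENNReal.ofReal (Real.exp (δ / 2 * (N + 1))) := by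
        rw [hhalf, ← ENNReal.ofReal_mul (Real.exp_pos _).le, ← Real.exp_add]
        congr 2
        ring
    _ ≤ ENNReal.ofReal (Real.exp (δ * (N + 1))) := by
        refine ENNReal.ofReal_le_ofReal (Real.exp_le_exp.2 ?_)
        nlinarith

end Summit.AtomisticToContinuum.HydrodynamicLimit.Theorems.KineticWindowGronwallLadder

end
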